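import Summits.QuantumFields.BalabanUV.Beta.GAN24.ArrowInnerShiftZeroBorder

/-!
# `BalabanUV.Beta.GAN24.ArrowInnerShiftAliasCoord` — binder row G-an2-4 / (CONV-C), road P1-fibre, row **P1-L10-F4** (`ArrowInnerShift`) of the
# L10 owner's cut `HOME/b2b-balaban-gan24-formalise-leaf-16/L10-CUT-M4.md` («(M4) scaled alias-space Neumann, two anchors»), PART 1c:
# ONE COORDINATE OF AN ALIAS OFF THE ANCHOR — the NUMERATOR FORM `‖s_i(m)(p)‖/N ≤ 2ρ/fold(m_i)` of the contour weight on an ACTIVE coordinate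
# (`m_i ≠ 0`) and `≤ 3` on an inactive one, on the complex polydisc `‖p_j‖ ≤ ρ ≤ 1/2`, UNIFORMLY IN `N`; squared majorant `wMaj N (m i)`

NOT IN PRINT; OUR PROOF ATTEMPT.  HONEST FRAMING (cell contract, verbatim): «discharging `BetaPertH` makes Bałaban's UV stability
UNCONDITIONAL — a real constructive-QFT result; it is NOT the continuum limit and NOT the Clay problem.»  HONEST DEPENDENCY (verbatim):
«continuum YM on T⁴ ⇐ BetaPertH ∧ nine spine estimates (0/9 proved); BetaPertH ⇐ (D1) ∧ (D4) ∧ CAP+tail; G-an2-4 gates asym, D1 and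
NE2/3/4.»  [folklore] bookkeeping estimates (geometric sums at complex argument, Jordan's inequality via `AliasWeights.fold_le_mul_abs_sin`);
NO cited fact, NO `def … : Prop` hypothesis, NO wall binder, NO new object (0 `def`).  NOT summit progress; nothing of (CONV-C)'s K-slot is discharged here.

## Why (row F4 of the cut, «borders m ≠ 0»; gan24-p1-g2's ratification CLAIMS l.3191 (1): «every m ≠ 0 border weight has an active factor
## gs(2πm_i/N, N) = 0 … entries O(|p|^ν·Π_{active} 1/|m_i|)»; owner's ruling R1 l.3224: the NUMERATOR form)
Every border weight of the arrow operator is a product over the coordinates of one-dimensional geometric sums `s_i(m)(p) = G(k_{m,i}(p), N)`, and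
`G(k_{m,i}, N)·(e^{ik_{m,i}} − 1) = e^{ip_i} − 1` EXACTLY (`AliasWeights.geomExp_mul_sub_one`, `e^{2πi·val} = 1`).  On an ACTIVE coordinate the
denominator stays away from zero on the whole polydisc: `‖e^{ik_{m,i}(p)} − 1‖ ≥ 2·fold/N − 2ρ/N ≥ fold/N` (`fold(r) = min(val r, N − val r) ≥ 1`; Jordan at the
REAL anchor `kfine N 0 m i = 2π·val/N`; `‖e^{iw} − 1‖ ≤ 2‖w‖`), so `‖s_i(m)(p)‖/N ≤ 2ρ/fold ≤ 2ρ·√(wMaj N (m i))`, and the weight VANISHES at `p = 0`.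
On an inactive coordinate `s_i(m)(p) = G(p_i/N, N)` and part 1b gives `‖·‖/N ≤ 3`.  Alias currency of `GAN24/AliasObjects`; independent of F1/F2.

## What is proved (general `D`, `N ≥ 1`, `hp : ∀ i, ‖p i‖ ≤ ρ`, `ρ ≤ 1/2`)
`kAl_mul_natCast`, `cexp_I_mul_kAl_mul_natCast` (`e^{i k_{m,i} N} = e^{ip_i}`) + flat twin, **`gs_kAl_mul`** (`s_i(m)·(e^{ik_{m,i}} − 1) = e^{ip_i} − 1`) + flat twin,
`one_le_fold`, `fold_le_mul_abs_sin_anchor`, `norm_cexp_I_mul_kAl_zero_sub_one` (`= 2|sin(kfine N 0 m i/2)|`) + flat twin,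
**`fold_div_le_norm_cexp_kAl_sub_one`** (`fold/N ≤ ‖e^{ik_{m,i}(p)} − 1‖`, `m_i ≠ 0`) + flat twin, **`norm_sAl_div_le_of_ne_zero`** (`‖s_i(m)(p)‖/N ≤ 2ρ/fold`)
+ flat twin, `inv_fold_sq_le_wMaj`, **`sq_norm_sAl_div_le_wMaj_of_ne_zero`** (`(‖s_i(m)‖/N)² ≤ 4ρ²·wMaj N (m i)`) + flat twin, `kAl_of_eq_zero`,
`norm_sAl_div_le_three_of_eq_zero` (`m_i = 0 ⇒ ‖s_i(m)‖/N ≤ 3`) + flat twin, **`sq_norm_sAl_div_le_nine`** (every coordinate: `(‖s_i(m)‖/N)² ≤ 9·wMaj N (m i)`)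
+ flat twin.  The products over the coordinates and the alias sums are part 1d `GAN24/ArrowInnerShiftAliasBorder`.
Constants displayed; no float enters any statement.  Unit `b2b-balaban-gan24-formalise-leaf-04` (G-an2-4 formalisation swarm, gen 5), 2026-08-20.
-/

noncomputable section

open Complex Finset
open scoped BigOperators Real
open Literature.Probability.LatticeModels (TorusSite)
open Literature.MathematicalPhysics.QuantumFieldTheory.LatticeForm (repZ)
open Summit.QuantumFields.BalabanUV.Beta.GAN24.AliasWeights (kfine wMaj wMaj_nonneg wMaj_zero fold_le_mul_abs_sin geomExp_mul_sub_one)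
open Summit.QuantumFields.BalabanUV.Beta.GAN24.AliasObjects (kAl kAl_apply gs sAl sbAl)
open Summit.QuantumFields.BalabanUV.Beta.GAN24.AliasStripSymbols (norm_cexp_I_mul_sub_one_le_two_mul)
open Summit.QuantumFields.BalabanUV.Beta.GAN24.ArrowInnerShiftScalars (kAl_eq_kAl_zero_add kAl_zero_apply norm_cexp_I_mul_kAl_zero
  norm_cexp_neg_I_mul_kAl_zero norm_cexp_neg_I_mul_sub_one_le norm_div_natCast_le_div norm_div_natCast_le_one)
open Summit.QuantumFields.BalabanUV.Beta.GAN24.ArrowInnerShiftZeroBorder (norm_gs_sub_natCast_le)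

namespace Summit.QuantumFields.BalabanUV.Beta.GAN24.ArrowInnerShiftAliasCoord

variable {D : ℕ} {N : ℕ} [NeZero N]

/-! ## §1 One coordinate: the exact numerator identity and the active-coordinate denominator bound -/

/-- [folklore] `kAl N p m i · N = p i + 2π·val(m i)`. -/
theorem kAl_mul_natCast (p : Fin D → ℂ) (m : TorusSite D N) (i : Fin D) :
    kAl N p m i * (N : ℂ) = p i + 2 * π * ((m i).val : ℂ) := by
  have hN : (N : ℂ) ≠ 0 := Nat.cast_ne_zero.2 (NeZero.ne N)
  rw [kAl_apply]
  simp only [repZ, Int.cast_natCast]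
  field_simp

/-- [folklore] The `N`-th power of the fine phase is the coarse phase: `e^{i k_{m,i} N} = e^{ip_i}` (`e^{2πi·val} = 1`). -/
theorem cexp_I_mul_kAl_mul_natCast (p : Fin D → ℂ) (m : TorusSite D N) (i : Fin D) :
    cexp (I * kAl N p m i * (N : ℂ)) = cexp (I * p i) := by
  rw [mul_assoc, kAl_mul_natCast, mul_add, Complex.exp_add]
  have h : cexp (I * (2 * π * ((m i).val : ℂ))) = 1 := by
    rw [show I * (2 * π * ((m i).val : ℂ)) = ((m i).val : ℕ) * (2 * π * I) by ring]
    exact Complex.exp_nat_mul_two_pi_mul_I _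
  rw [h, mul_one]

/-- [folklore] Flat twin: `e^{−i k_{m,i} N} = e^{−ip_i}`. -/
theorem cexp_neg_I_mul_kAl_mul_natCast (p : Fin D → ℂ) (m : TorusSite D N) (i : Fin D) :
    cexp (I * (-kAl N p m i) * (N : ℂ)) = cexp (-(I * p i)) := by
  have h := cexp_I_mul_kAl_mul_natCast p m i
  rw [show I * (-kAl N p m i) * (N : ℂ) = -(I * kAl N p m i * (N : ℂ)) by ring, Complex.exp_neg, h, ← Complex.exp_neg]

/-- [folklore] **NUMERATOR IDENTITY**: `s_i(m)(p)·(e^{ik_{m,i}} − 1) = e^{ip_i} − 1`. -/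
theorem gs_kAl_mul (p : Fin D → ℂ) (m : TorusSite D N) (i : Fin D) :
    sAl N p m i * (cexp (I * kAl N p m i) - 1) = cexp (I * p i) - 1 := by
  unfold AliasObjects.sAl AliasObjects.gs
  rw [geomExp_mul_sub_one, cexp_I_mul_kAl_mul_natCast]

/-- [folklore] Flat twin: `s♭_i(m)(p)·(e^{−ik_{m,i}} − 1) = e^{−ip_i} − 1`. -/
theorem gs_neg_kAl_mul (p : Fin D → ℂ) (m : TorusSite D N) (i : Fin D) :
    sbAl N p m i * (cexp (I * (-kAl N p m i)) - 1) = cexp (-(I * p i)) - 1 := by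
  unfold AliasObjects.sbAl AliasObjects.gs
  rw [geomExp_mul_sub_one, cexp_neg_I_mul_kAl_mul_natCast]

/-- [folklore] An active coordinate has `1 ≤ fold(m_i) = min(val, N − val)`. -/
theorem one_le_fold {m : TorusSite D N} {i : Fin D} (hi : m i ≠ 0) : (1 : ℝ) ≤ ((min (m i).val (N - (m i).val) : ℕ) : ℝ) := by
  have hv0 : 1 ≤ (m i).val := Nat.one_le_iff_ne_zero.2 fun h0 => hi ((ZMod.val_eq_zero _).1 h0)
  have hvN : (m i).val + 1 ≤ N := ZMod.val_lt (m i)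
  exact_mod_cast le_min hv0 (by omega)

/-- [folklore] JORDAN AT THE ANCHOR: `fold(m_i) ≤ N·|sin(kfine N 0 m i / 2)|` for an active coordinate (`AliasWeights.fold_le_mul_abs_sin` at `p = 0`). -/
theorem fold_le_mul_abs_sin_anchor {m : TorusSite D N} {i : Fin D} (hi : m i ≠ 0) :
    ((min (m i).val (N - (m i).val) : ℕ) : ℝ) ≤ (N : ℝ) * |Real.sin (kfine N 0 m i / 2)| := by
  have hv0 : 1 ≤ (m i).val := Nat.one_le_iff_ne_zero.2 fun h0 => hi ((ZMod.val_eq_zero _).1 h0)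
  have hvN : (m i).val + 1 ≤ N := ZMod.val_lt (m i)
  have h := fold_le_mul_abs_sin (p := (0 : ℝ)) (by simp [Real.pi_pos.le]) hv0 hvN
  simpa [kfine] using h

/-- [folklore] The anchor phase defect has modulus `2|sin(kfine N 0 m i/2)|`: `‖e^{i kAl N 0 m i} − 1‖ = 2|sin(kfine N 0 m i / 2)|`. -/
theorem norm_cexp_I_mul_kAl_zero_sub_one (m : TorusSite D N) (i : Fin D) :
    ‖cexp (I * kAl N (0 : Fin D → ℂ) m i) - 1‖ = 2 * |Real.sin (kfine N 0 m i / 2)| := by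
  rw [kAl_zero_apply, Complex.norm_exp_I_mul_ofReal_sub_one, Real.norm_eq_abs, abs_mul, abs_two]

/-- [folklore] Flat twin: `‖e^{−i kAl N 0 m i} − 1‖ = 2|sin(kfine N 0 m i / 2)|`. -/
theorem norm_cexp_neg_I_mul_kAl_zero_sub_one (m : TorusSite D N) (i : Fin D) :
    ‖cexp (I * (-kAl N (0 : Fin D → ℂ) m i)) - 1‖ = 2 * |Real.sin (kfine N 0 m i / 2)| := by
  rw [kAl_zero_apply, show I * (-((kfine N 0 m i : ℝ) : ℂ)) = I * ((-kfine N 0 m i : ℝ) : ℂ) by push_cast; ring,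
    Complex.norm_exp_I_mul_ofReal_sub_one, Real.norm_eq_abs, abs_mul, abs_two, neg_div, Real.sin_neg, abs_neg]

/-- [folklore] **ACTIVE-COORDINATE DENOMINATOR**: for `m_i ≠ 0`, `‖p_j‖ ≤ ρ ≤ 1/2`:  `fold(m_i)/N ≤ ‖e^{i k_{m,i}(p)} − 1‖`
(`e^{i(θ+w)} − 1 = e^{iθ}(e^{iw} − 1) + (e^{iθ} − 1)`, `‖e^{iθ} − 1‖ = 2|sin(θ/2)| ≥ 2 fold/N`, `‖e^{iw} − 1‖ ≤ 2ρ/N ≤ fold/N`). -/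
theorem fold_div_le_norm_cexp_kAl_sub_one {p : Fin D → ℂ} {ρ : ℝ} (hp : ∀ i, ‖p i‖ ≤ ρ) (hρ : ρ ≤ 1 / 2)
    {m : TorusSite D N} {i : Fin D} (hi : m i ≠ 0) :
    ((min (m i).val (N - (m i).val) : ℕ) : ℝ) / N ≤ ‖cexp (I * kAl N p m i) - 1‖ := by
  set f : ℝ := ((min (m i).val (N - (m i).val) : ℕ) : ℝ) with hf
  have hN : (0 : ℝ) < (N : ℝ) := by exact_mod_cast Nat.pos_of_ne_zero (NeZero.ne N)
  have hf1 : 1 ≤ f := one_le_fold hi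
  have hfold : f ≤ (N : ℝ) * |Real.sin (kfine N 0 m i / 2)| := fold_le_mul_abs_sin_anchor hi
  -- decomposition
  have e : cexp (I * kAl N p m i) - 1
      = cexp (I * kAl N 0 m i) * (cexp (I * (p i / (N : ℂ))) - 1) + (cexp (I * kAl N 0 m i) - 1) := by
    rw [kAl_eq_kAl_zero_add p m i, mul_add, Complex.exp_add]; ring
  have hw : ‖cexp (I * (p i / (N : ℂ))) - 1‖ ≤ 2 * (ρ / N) :=
    (norm_cexp_I_mul_sub_one_le_two_mul (norm_div_natCast_le_one hp (by linarith) i)).trans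
      (by have := norm_div_natCast_le_div (N := N) hp i; linarith)
  have hanchor : ‖cexp (I * kAl N (0 : Fin D → ℂ) m i) - 1‖ = 2 * |Real.sin (kfine N 0 m i / 2)| :=
    norm_cexp_I_mul_kAl_zero_sub_one m i
  -- reverse triangle inequality
  have htri : ‖cexp (I * kAl N (0 : Fin D → ℂ) m i) - 1‖ - ‖cexp (I * kAl N 0 m i) * (cexp (I * (p i / (N : ℂ))) - 1)‖
      ≤ ‖cexp (I * kAl N p m i) - 1‖ := by
    rw [e]
    have := norm_sub_le_norm_add (cexp (I * kAl N (0 : Fin D → ℂ) m i) - 1) (cexp (I * kAl N 0 m i) * (cexp (I * (p i / (N : ℂ))) - 1))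
    -- ‖a‖ - ‖b‖ ≤ ‖b + a‖
    have h2 := abs_norm_sub_norm_le (cexp (I * kAl N (0 : Fin D → ℂ) m i) - 1) (-(cexp (I * kAl N 0 m i) * (cexp (I * (p i / (N : ℂ))) - 1)))
    rw [norm_neg, sub_neg_eq_add] at h2
    have h3 := le_abs_self (‖cexp (I * kAl N (0 : Fin D → ℂ) m i) - 1‖ - ‖cexp (I * kAl N 0 m i) * (cexp (I * (p i / (N : ℂ))) - 1)‖)
    rw [add_comm] at h2
    linarith
  rw [norm_mul, norm_cexp_I_mul_kAl_zero, one_mul, hanchor] at htri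
  -- 2 fold/N - 2ρ/N ≤ …, and 2ρ/N ≤ fold/N
  have h1 : 2 * (f / N) ≤ 2 * |Real.sin (kfine N 0 m i / 2)| := by
    have : f / N ≤ |Real.sin (kfine N 0 m i / 2)| := by rw [div_le_iff₀ hN, mul_comm]; exact hfold
    linarith
  have h2 : 2 * (ρ / N) ≤ f / N := by
    rw [mul_div_assoc', div_le_div_iff_of_pos_right hN]; linarith
  linarith

/-- [folklore] Flat twin: `fold(m_i)/N ≤ ‖e^{−i k_{m,i}(p)} − 1‖`. -/
theorem fold_div_le_norm_cexp_neg_kAl_sub_one {p : Fin D → ℂ} {ρ : ℝ} (hp : ∀ i, ‖p i‖ ≤ ρ) (hρ : ρ ≤ 1 / 2)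
    {m : TorusSite D N} {i : Fin D} (hi : m i ≠ 0) :
    ((min (m i).val (N - (m i).val) : ℕ) : ℝ) / N ≤ ‖cexp (I * (-kAl N p m i)) - 1‖ := by
  set f : ℝ := ((min (m i).val (N - (m i).val) : ℕ) : ℝ) with hf
  have hN : (0 : ℝ) < (N : ℝ) := by exact_mod_cast Nat.pos_of_ne_zero (NeZero.ne N)
  have hf1 : 1 ≤ f := one_le_fold hi
  have hfold : f ≤ (N : ℝ) * |Real.sin (kfine N 0 m i / 2)| := fold_le_mul_abs_sin_anchor hi
  have e : cexp (I * (-kAl N p m i)) - 1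
      = cexp (I * (-kAl N 0 m i)) * (cexp (-(I * (p i / (N : ℂ)))) - 1) + (cexp (I * (-kAl N 0 m i)) - 1) := by
    rw [kAl_eq_kAl_zero_add p m i, neg_add, mul_add, Complex.exp_add, ← mul_neg]; ring
  have hw : ‖cexp (-(I * (p i / (N : ℂ)))) - 1‖ ≤ 2 * (ρ / N) :=
    (norm_cexp_neg_I_mul_sub_one_le (norm_div_natCast_le_one hp (by linarith) i)).trans
      (by have := norm_div_natCast_le_div (N := N) hp i; linarith)
  have hanchor : ‖cexp (I * (-kAl N (0 : Fin D → ℂ) m i)) - 1‖ = 2 * |Real.sin (kfine N 0 m i / 2)| :=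
    norm_cexp_neg_I_mul_kAl_zero_sub_one m i
  have hph : ‖cexp (I * (-kAl N (0 : Fin D → ℂ) m i))‖ = 1 := by
    rw [mul_neg]; exact norm_cexp_neg_I_mul_kAl_zero m i
  have htri : ‖cexp (I * (-kAl N (0 : Fin D → ℂ) m i)) - 1‖ - ‖cexp (I * (-kAl N 0 m i)) * (cexp (-(I * (p i / (N : ℂ)))) - 1)‖
      ≤ ‖cexp (I * (-kAl N p m i)) - 1‖ := by
    rw [e]
    have h2 := abs_norm_sub_norm_le (cexp (I * (-kAl N (0 : Fin D → ℂ) m i)) - 1)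
      (-(cexp (I * (-kAl N 0 m i)) * (cexp (-(I * (p i / (N : ℂ)))) - 1)))
    rw [norm_neg, sub_neg_eq_add] at h2
    have h3 := le_abs_self (‖cexp (I * (-kAl N (0 : Fin D → ℂ) m i)) - 1‖
      - ‖cexp (I * (-kAl N 0 m i)) * (cexp (-(I * (p i / (N : ℂ)))) - 1)‖)
    rw [add_comm] at h2
    linarith
  rw [norm_mul, hph, one_mul, hanchor] at htri
  have h1 : 2 * (f / N) ≤ 2 * |Real.sin (kfine N 0 m i / 2)| := by
    have : f / N ≤ |Real.sin (kfine N 0 m i / 2)| := by rw [div_le_iff₀ hN, mul_comm]; exact hfold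
    linarith
  have h2 : 2 * (ρ / N) ≤ f / N := by
    rw [mul_div_assoc', div_le_div_iff_of_pos_right hN]; linarith
  linarith

/-- [folklore] **NUMERATOR FORM** on an active coordinate: `‖s_i(m)(p)‖/N ≤ 2ρ/fold(m_i)` (`m_i ≠ 0`, `‖p_j‖ ≤ ρ ≤ 1/2`). -/
theorem norm_sAl_div_le_of_ne_zero {p : Fin D → ℂ} {ρ : ℝ} (hp : ∀ i, ‖p i‖ ≤ ρ) (hρ : ρ ≤ 1 / 2)
    {m : TorusSite D N} {i : Fin D} (hi : m i ≠ 0) :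
    ‖sAl N p m i‖ / N ≤ 2 * ρ / ((min (m i).val (N - (m i).val) : ℕ) : ℝ) := by
  set f : ℝ := ((min (m i).val (N - (m i).val) : ℕ) : ℝ) with hf
  have hN : (0 : ℝ) < (N : ℝ) := by exact_mod_cast Nat.pos_of_ne_zero (NeZero.ne N)
  have hf1 : 1 ≤ f := one_le_fold hi
  have hf0 : 0 < f := by linarith
  have hden := fold_div_le_norm_cexp_kAl_sub_one hp hρ hi
  have hnum : ‖cexp (I * p i) - 1‖ ≤ 2 * ρ :=
    (norm_cexp_I_mul_sub_one_le_two_mul ((hp i).trans (by linarith))).trans (by linarith [hp i])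
  have hprod : ‖sAl N p m i‖ * ‖cexp (I * kAl N p m i) - 1‖ ≤ 2 * ρ := by
    rw [← norm_mul, gs_kAl_mul]; exact hnum
  have hmain : ‖sAl N p m i‖ * (f / N) ≤ 2 * ρ :=
    (mul_le_mul_of_nonneg_left hden (norm_nonneg _)).trans hprod
  rw [div_le_div_iff₀ hN hf0]
  have := mul_le_mul_of_nonneg_right hmain hN.le
  calc ‖sAl N p m i‖ * f = ‖sAl N p m i‖ * (f / N) * N := by field_simp
    _ ≤ 2 * ρ * N := this

/-- [folklore] Flat twin: `‖s♭_i(m)(p)‖/N ≤ 2ρ/fold(m_i)`. -/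
theorem norm_sbAl_div_le_of_ne_zero {p : Fin D → ℂ} {ρ : ℝ} (hp : ∀ i, ‖p i‖ ≤ ρ) (hρ : ρ ≤ 1 / 2)
    {m : TorusSite D N} {i : Fin D} (hi : m i ≠ 0) :
    ‖sbAl N p m i‖ / N ≤ 2 * ρ / ((min (m i).val (N - (m i).val) : ℕ) : ℝ) := by
  set f : ℝ := ((min (m i).val (N - (m i).val) : ℕ) : ℝ) with hf
  have hN : (0 : ℝ) < (N : ℝ) := by exact_mod_cast Nat.pos_of_ne_zero (NeZero.ne N)
  have hf1 : 1 ≤ f := one_le_fold hi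
  have hf0 : 0 < f := by linarith
  have hden := fold_div_le_norm_cexp_neg_kAl_sub_one hp hρ hi
  have hnum : ‖cexp (-(I * p i)) - 1‖ ≤ 2 * ρ :=
    (norm_cexp_neg_I_mul_sub_one_le ((hp i).trans (by linarith))).trans (by linarith [hp i])
  have hprod : ‖sbAl N p m i‖ * ‖cexp (I * (-kAl N p m i)) - 1‖ ≤ 2 * ρ := by
    rw [← norm_mul, gs_neg_kAl_mul]; exact hnum
  have hmain : ‖sbAl N p m i‖ * (f / N) ≤ 2 * ρ :=
    (mul_le_mul_of_nonneg_left hden (norm_nonneg _)).trans hprod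
  rw [div_le_div_iff₀ hN hf0]
  have := mul_le_mul_of_nonneg_right hmain hN.le
  calc ‖sbAl N p m i‖ * f = ‖sbAl N p m i‖ * (f / N) * N := by field_simp
    _ ≤ 2 * ρ * N := this

omit [NeZero N] in
/-- [folklore] The majorant dominates the inverse folded square: `1/fold(r)² ≤ wMaj N r` for `r ≠ 0`. -/
theorem inv_fold_sq_le_wMaj {r : ZMod N} (hr : r ≠ 0) : 1 / (((min r.val (N - r.val) : ℕ) : ℝ)) ^ 2 ≤ wMaj N r := by
  unfold wMaj
  rw [if_neg hr]
  rcases Nat.le_total r.val (N - r.val) with hab | hab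
  · rw [min_eq_left hab, one_div]
    exact le_add_of_nonneg_right (by positivity)
  · rw [min_eq_right hab, one_div]
    exact le_add_of_nonneg_left (by positivity)

/-- [folklore] **SQUARED MAJORANT, ACTIVE COORDINATE**: `(‖s_i(m)(p)‖/N)² ≤ 4ρ²·wMaj N (m i)` for `m_i ≠ 0`. -/
theorem sq_norm_sAl_div_le_wMaj_of_ne_zero {p : Fin D → ℂ} {ρ : ℝ} (hp : ∀ i, ‖p i‖ ≤ ρ) (hρ : ρ ≤ 1 / 2)
    {m : TorusSite D N} {i : Fin D} (hi : m i ≠ 0) :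
    (‖sAl N p m i‖ / N) ^ 2 ≤ 4 * ρ ^ 2 * wMaj N (m i) := by
  have h := norm_sAl_div_le_of_ne_zero hp hρ hi
  have hw := inv_fold_sq_le_wMaj (N := N) hi
  have hf1 : (1 : ℝ) ≤ ((min (m i).val (N - (m i).val) : ℕ) : ℝ) := one_le_fold hi
  have hρ0 : 0 ≤ ρ := (norm_nonneg _).trans (hp i)
  have h0 : 0 ≤ ‖sAl N p m i‖ / N := div_nonneg (norm_nonneg _) (Nat.cast_nonneg N)
  calc (‖sAl N p m i‖ / N) ^ 2 ≤ (2 * ρ / ((min (m i).val (N - (m i).val) : ℕ) : ℝ)) ^ 2 := pow_le_pow_left₀ h0 h 2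
    _ = 4 * ρ ^ 2 * (1 / (((min (m i).val (N - (m i).val) : ℕ) : ℝ)) ^ 2) := by field_simp; ring
    _ ≤ 4 * ρ ^ 2 * wMaj N (m i) := mul_le_mul_of_nonneg_left hw (by positivity)

/-- [folklore] Flat twin: `(‖s♭_i(m)(p)‖/N)² ≤ 4ρ²·wMaj N (m i)` for `m_i ≠ 0`. -/
theorem sq_norm_sbAl_div_le_wMaj_of_ne_zero {p : Fin D → ℂ} {ρ : ℝ} (hp : ∀ i, ‖p i‖ ≤ ρ) (hρ : ρ ≤ 1 / 2)
    {m : TorusSite D N} {i : Fin D} (hi : m i ≠ 0) :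
    (‖sbAl N p m i‖ / N) ^ 2 ≤ 4 * ρ ^ 2 * wMaj N (m i) := by
  have h := norm_sbAl_div_le_of_ne_zero hp hρ hi
  have hw := inv_fold_sq_le_wMaj (N := N) hi
  have hf1 : (1 : ℝ) ≤ ((min (m i).val (N - (m i).val) : ℕ) : ℝ) := one_le_fold hi
  have hρ0 : 0 ≤ ρ := (norm_nonneg _).trans (hp i)
  have h0 : 0 ≤ ‖sbAl N p m i‖ / N := div_nonneg (norm_nonneg _) (Nat.cast_nonneg N)
  calc (‖sbAl N p m i‖ / N) ^ 2 ≤ (2 * ρ / ((min (m i).val (N - (m i).val) : ℕ) : ℝ)) ^ 2 := pow_le_pow_left₀ h0 h 2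
    _ = 4 * ρ ^ 2 * (1 / (((min (m i).val (N - (m i).val) : ℕ) : ℝ)) ^ 2) := by field_simp; ring
    _ ≤ 4 * ρ ^ 2 * wMaj N (m i) := mul_le_mul_of_nonneg_left hw (by positivity)

/-- [folklore] An inactive coordinate sees only the coarse momentum: `m_i = 0 ⇒ kAl N p m i = p i / N`. -/
theorem kAl_of_eq_zero (p : Fin D → ℂ) {m : TorusSite D N} {i : Fin D} (hi : m i = 0) : kAl N p m i = p i / (N : ℂ) := by
  rw [kAl_apply]
  simp [repZ, hi]

/-- [folklore] INACTIVE COORDINATE: `m_i = 0 ⇒ ‖s_i(m)(p)‖/N ≤ 3` (it is `G(p_i/N, N)`, `≤ N + 2ρN`). -/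
theorem norm_sAl_div_le_three_of_eq_zero {p : Fin D → ℂ} {ρ : ℝ} (hp : ∀ i, ‖p i‖ ≤ ρ) (hρ1 : ρ ≤ 1)
    {m : TorusSite D N} {i : Fin D} (hi : m i = 0) : ‖sAl N p m i‖ / N ≤ 3 := by
  have hN : (0 : ℝ) < (N : ℝ) := by exact_mod_cast Nat.pos_of_ne_zero (NeZero.ne N)
  unfold AliasObjects.sAl
  rw [kAl_of_eq_zero p hi]
  have hw : ‖p i / (N : ℂ)‖ * N ≤ 1 := by
    rw [norm_div, Complex.norm_natCast, div_mul_cancel₀ _ hN.ne']; exact (hp i).trans hρ1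
  have h := norm_gs_sub_natCast_le hw
  have h2 : ‖gs (p i / (N : ℂ)) N - N‖ ≤ 2 * N := by
    refine h.trans ?_
    rw [norm_div, Complex.norm_natCast]
    have : ‖p i‖ ≤ 1 := (hp i).trans hρ1
    have e : 2 * (‖p i‖ / N) * (N : ℝ) ^ 2 = 2 * ‖p i‖ * N := by field_simp
    rw [e]; nlinarith
  have h3 : ‖gs (p i / (N : ℂ)) N‖ ≤ 3 * N := by
    have e : gs (p i / (N : ℂ)) N = (gs (p i / (N : ℂ)) N - N) + N := by ring
    rw [e]
    refine (norm_add_le _ _).trans ?_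
    rw [Complex.norm_natCast]; linarith
  rw [div_le_iff₀ hN]; exact h3

/-- [folklore] Flat twin: `m_i = 0 ⇒ ‖s♭_i(m)(p)‖/N ≤ 3`. -/
theorem norm_sbAl_div_le_three_of_eq_zero {p : Fin D → ℂ} {ρ : ℝ} (hp : ∀ i, ‖p i‖ ≤ ρ) (hρ1 : ρ ≤ 1)
    {m : TorusSite D N} {i : Fin D} (hi : m i = 0) : ‖sbAl N p m i‖ / N ≤ 3 := by
  have hN : (0 : ℝ) < (N : ℝ) := by exact_mod_cast Nat.pos_of_ne_zero (NeZero.ne N)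
  unfold AliasObjects.sbAl
  rw [kAl_of_eq_zero p hi]
  have hw : ‖-(p i / (N : ℂ))‖ * N ≤ 1 := by
    rw [norm_neg, norm_div, Complex.norm_natCast, div_mul_cancel₀ _ hN.ne']; exact (hp i).trans hρ1
  have h := norm_gs_sub_natCast_le hw
  have h2 : ‖gs (-(p i / (N : ℂ))) N - N‖ ≤ 2 * N := by
    refine h.trans ?_
    rw [norm_neg, norm_div, Complex.norm_natCast]
    have : ‖p i‖ ≤ 1 := (hp i).trans hρ1
    have e : 2 * (‖p i‖ / N) * (N : ℝ) ^ 2 = 2 * ‖p i‖ * N := by field_simp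
    rw [e]; nlinarith
  have h3 : ‖gs (-(p i / (N : ℂ))) N‖ ≤ 3 * N := by
    have e : gs (-(p i / (N : ℂ))) N = (gs (-(p i / (N : ℂ))) N - N) + N := by ring
    rw [e]
    refine (norm_add_le _ _).trans ?_
    rw [Complex.norm_natCast]; linarith
  rw [div_le_iff₀ hN]; exact h3

/-- [folklore] EVERY COORDINATE: `(‖s_i(m)(p)‖/N)² ≤ 9·wMaj N (m i)` (`ρ ≤ 1/2`; active: `4ρ²·wMaj ≤ wMaj`; inactive: `9 = 9·wMaj N 0`). -/
theorem sq_norm_sAl_div_le_nine {p : Fin D → ℂ} {ρ : ℝ} (hp : ∀ i, ‖p i‖ ≤ ρ) (hρ : ρ ≤ 1 / 2) (m : TorusSite D N) (i : Fin D) :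
    (‖sAl N p m i‖ / N) ^ 2 ≤ 9 * wMaj N (m i) := by
  by_cases hi : m i = 0
  · have h := norm_sAl_div_le_three_of_eq_zero hp (by linarith) hi
    have h0 : 0 ≤ ‖sAl N p m i‖ / N := div_nonneg (norm_nonneg _) (Nat.cast_nonneg N)
    rw [hi, wMaj_zero, mul_one]
    nlinarith
  · have h := sq_norm_sAl_div_le_wMaj_of_ne_zero hp hρ hi
    have hw := wMaj_nonneg N (m i)
    have hρ0 : 0 ≤ ρ := (norm_nonneg _).trans (hp i)
    have hρ2 : ρ ^ 2 ≤ 1 := by nlinarith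
    have h4 : 4 * ρ ^ 2 * wMaj N (m i) ≤ 9 * wMaj N (m i) := by nlinarith [mul_le_mul_of_nonneg_right hρ2 hw]
    exact h.trans h4

/-- [folklore] Flat twin: `(‖s♭_i(m)(p)‖/N)² ≤ 9·wMaj N (m i)`. -/
theorem sq_norm_sbAl_div_le_nine {p : Fin D → ℂ} {ρ : ℝ} (hp : ∀ i, ‖p i‖ ≤ ρ) (hρ : ρ ≤ 1 / 2) (m : TorusSite D N) (i : Fin D) :
    (‖sbAl N p m i‖ / N) ^ 2 ≤ 9 * wMaj N (m i) := by
  by_cases hi : m i = 0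
  · have h := norm_sbAl_div_le_three_of_eq_zero hp (by linarith) hi
    have h0 : 0 ≤ ‖sbAl N p m i‖ / N := div_nonneg (norm_nonneg _) (Nat.cast_nonneg N)
    rw [hi, wMaj_zero, mul_one]
    nlinarith
  · have h := sq_norm_sbAl_div_le_wMaj_of_ne_zero hp hρ hi
    have hw := wMaj_nonneg N (m i)
    have hρ0 : 0 ≤ ρ := (norm_nonneg _).trans (hp i)
    have hρ2 : ρ ^ 2 ≤ 1 := by nlinarith
    have h4 : 4 * ρ ^ 2 * wMaj N (m i) ≤ 9 * wMaj N (m i) := by nlinarith [mul_le_mul_of_nonneg_right hρ2 hw]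
    exact h.trans h4

end Summit.QuantumFields.BalabanUV.Beta.GAN24.ArrowInnerShiftAliasCoord

end
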